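import Summits.ResolutionOfSingularities.ResolutionOfSingularities.Theorems.FrobeniusLadderFInjectiveMacaulayficationP2d4CTauKChar2Fan
import Summits.ResolutionOfSingularities.ResolutionOfSingularities.Theorems.FrobeniusLadderFInjectiveMacaulayficationP2d4CChar2Germ
import Summits.ResolutionOfSingularities.ResolutionOfSingularities.Theorems.FrobeniusLadderFInjectiveMacaulayficationPointFixableOfCert
import Summits.ResolutionOfSingularities.ResolutionOfSingularities.Theorems.FrobeniusLadderFInjectiveMacaulayficationGermOfPointFixable
import Summits.ResolutionOfSingularities.ResolutionOfSingularities.Theorems.FrobeniusLadderFInjectiveMacaulayficationRegularBlowupModelDim2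
import Literature.AlgebraicGeometry.Resolution.AffineBlowupUnique
import Literature.AlgebraicGeometry.Resolution.AffineBlowupUniversal
import Literature.AlgebraicGeometry.Resolution.AffineBlowupIntegral
import Literature.AlgebraicGeometry.Resolution.BlowupsFlatBaseChange
import HarnessLib

/-!
# F4POS-2a′ (β′): THE BLOWING UP OF P2d4C ALONG THE PRODUCT CENTRE `τ·K` IS FULL AT EVERY POINT — PINNED CENTRE, EXPLICIT MODEL, AND THE EXPORT
# `hrow_P2d4C` IN F4POS-2b's LETTER (crux `FInjectiveMacaulayfication` stmt-ResolutionOfSingularities-15315, chain w45a; res-L1-w45a-plan-1 RULINGS R18.15 /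
# R18.16 (2) / R18.18 «F4POS-2a′ := the PRODUCT-IDEAL certificate ada44c2874c63a18; then res-L1-w45a-stub-3 appends `tauFloor_P2d4C_row` with one `exact`»;
# seat res-L1-w45a-stub-2 g8; data `P2d4CTauKChar2Fan`; consumer `FHalfRowOfProductCentre.tauFloor_P2d4C_cure` (p618085))

[OURS · L1 W4.5a] Support file (`--supports stmt-ResolutionOfSingularities-15315 --as helper`); def-free, unconditional; replaces the role of NO printed item;
NOT a statement of the manuscript; AI-written (AI review is weaker than expert review).

SETTING. `X = Spec R̄`, `R̄ = k[x,y,u,t,z]/(f)`, `f = z² + x⁴z + y³ + u³ + t³`, `char k = 2` (specimen `FCentreE1RungZero`), `v` = the vertex; `τ = (x̄², ȳ, ū, t̄, z̄)`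
(res-L1-w45a-plan-1's test-ideal centre of floor 0, TAU-PROBE); `K ⊂ R̄` = the image of the 22-monomial `𝔪`-primary ideal `(x^b : b ∈ P2d4CTauKChar2Fan.KA)`
(res-L1-w45a-idea-1 g20's FACTOR of the clean `Σ_τ`-refining fan, factor file 6984e77c8fc6f0f1); `I_A ⊂ R̄` = the image of the 67-generator monomial ideal of
`P2d4CTauKChar2Fan.A` (product certificate ada44c2874c63a18; SAME fan `(1,1,1,1,1) → (1,2,2,2,2) → (1,2,2,2,3)` and same 13 charts as `P2d4CTauRefChar2Fan` / p618502).
* §1 `affineBlowup_tauK_fullCl_over` — every stalk of `affineBlowup I_A` over `V(I_A)` is FULL (frame presentation; `CICertificates.ciCertificates` on the kernel-checked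
  tables + `PointFixableOfCert.affineBlowup_fiClause_over_of_cert`) — p618502 §1 verbatim on the new tables;
* §2 `affineBlowup_tauK_fullCl` (EVERY stalk FULL; off the vertex `X` is regular and the blow-up an isomorphism), `support_idealSheaf_tauK` (`supp Ĩ_A = {v}`),
  `forall_isBlowup_tauK_fullCl` (every blowing up along `Ĩ_A` is FULL at every point, `IsBlowup.unique`) — p618502 §2 verbatim on the new tables;
* §3 ★ `span_A_eq_tau_mul_K` — **THE CERTIFIED CENTRE IS LITERALLY THE PRODUCT**: `span (x^A) = span {x̄0², x̄1, x̄2, x̄3, x̄4} * span (x^KA)` in `k[X]/(f)` (ANY `f`),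
  from the two exponent-divisibility tables `P2d4CTauKChar2Fan.hAK_raw` / `hKA_raw` (each one kernel `decide`) by `monomial_mul`; `span_KA_ne_bot` (`x̄⁵ ∈ K`, `x̄ ≠ 0`);
  `span_range_X_le_radical_span_KA` (`𝔪_v ⊆ √K`: pure powers `x⁵, y³, u³, t³, z³ ∈ KA`); ★★ `hrow_P2d4C` — `∀ y : affineBlowup (τ_f * K), FullCl 2 (stalk y)` with
  `τ_f := span {x̄0², x̄1, x̄2, x̄3, x̄4}` WRITTEN EXACTLY AS IN `FHalfRowOfProductCentre.tauFloor_P2d4C_cure`'s binder `hrow` (§2 transported along §3 by `rw`).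
  With these three, res-L1-w45a-stub-3's row is the term `tauFloor_P2d4C_cure k f hf v hv _ (span_KA_ne_bot k f hf) (span_range_X_le_radical_span_KA k f) (hrow_P2d4C k f hf)`.
HONESTY. As for p618502: this is the OUTPUT half of the F(4)-pos row in GLOBAL affine form (an F(4)-iso-currency fact about `(X, v)` with centre `τ·K`); what makes the row
«F(4)-pos» is the INPUT legality of the τ-floor `S′ = Bl_τ X` (non-FULL along a 3-fold: p615290, p617516; CM / admissible / regular off the fibre: F4POS-1 (c)/(d),
res-L1-w45a-stub-1) + res-L1-w45a-stub-3's composition `IsBlowup.comp` (p618085). Nothing of [claim: Hironaka2017] is used. [folklore glue; cite: Fedder1983, Thm. 1.12;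
StacksProject, Tag 0804; StacksProject, Tag 080A; GortzWedhorn2020, Prop. 13.91 and Prop. 13.92; CoxLittleSchenck2011, §2.3]
-/

-- single-problem summit: the doubled namespace component is forced
set_option linter.dupNamespace false

noncomputable section

open AlgebraicGeometry CategoryTheory Literature.AlgebraicGeometry.Resolution TopologicalSpace IsLocalRing MvPolynomial

namespace Summit.ResolutionOfSingularities.ResolutionOfSingularities.Theorems.FInjectiveMacaulayfication.P2d4CTauKBlowupFull

open Summit.ResolutionOfSingularities.ResolutionOfSingularities.Theorems.FInjectiveMacaulayfication
open SliceableCentre FCentreE1ChartWitness FCentreE1ChartPresentation FCentreE1RungZero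

/-! ## §1 Over the centre, in the frame's presentation `k[X]/(Set.range ![f])` -/

set_option maxHeartbeats 800000 in
-- the frame's binder block is large; instantiation is by name
/-- **Every stalk of `affineBlowup I_{A′}` OVER `V(I_{A′})` is FULL** (frame presentation `k[X]/(Set.range Fs)`, `Fs = ![f]`): the road-B certificate
(`CICertificates.ciCertificates` on `P2d4CTauKChar2Fan`'s kernel-checked tables, `hon'` from `RoadBFrame.hon_of_kernelChecks`) fed to
`PointFixableOfCert.affineBlowup_fiClause_over_of_cert`. [folklore glue; cite: Fedder1983, Thm. 1.12; StacksProject, Tag 0804] -/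
theorem affineBlowup_tauK_fullCl_over (k : Type) [Field k] [CharP k 2] (Fs : Fin 1 → MvPolynomial (Fin 5) k)
    (hFs : Fs = ![X 4 ^ 2 + X 0 ^ 4 * X 4 + X 1 ^ 3 + X 2 ^ 3 + X 3 ^ 3]) :
    ∀ y : ↥(affineBlowup (Ideal.span ((fun e : Fin 5 →₀ ℕ => Ideal.Quotient.mk (Ideal.span (Set.range Fs)) (monomial e (1 : k))) ''
        (P2d4CTauKChar2Fan.A : Set (Fin 5 →₀ ℕ))))),
      Ideal.span ((fun e : Fin 5 →₀ ℕ => Ideal.Quotient.mk (Ideal.span (Set.range Fs)) (monomial e (1 : k))) ''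
          (P2d4CTauKChar2Fan.A : Set (Fin 5 →₀ ℕ))) ≤
        ((affineBlowup.π (Ideal.span ((fun e : Fin 5 →₀ ℕ => Ideal.Quotient.mk (Ideal.span (Set.range Fs)) (monomial e (1 : k))) ''
          (P2d4CTauKChar2Fan.A : Set (Fin 5 →₀ ℕ))))).base y).asIdeal →
      FullCl 2 ((affineBlowup (Ideal.span ((fun e : Fin 5 →₀ ℕ => Ideal.Quotient.mk (Ideal.span (Set.range Fs)) (monomial e (1 : k))) ''
        (P2d4CTauKChar2Fan.A : Set (Fin 5 →₀ ℕ))))).presheaf.stalk y) := by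
  classical
  haveI : Fact (Nat.Prime 2) := ⟨Nat.prime_two⟩
  subst hFs
  set f : MvPolynomial (Fin 5) k := X 4 ^ 2 + X 0 ^ 4 * X 4 + X 1 ^ 3 + X 2 ^ 3 + X 3 ^ 3 with hf
  have hr : Set.range (![f] : Fin 1 → MvPolynomial (Fin 5) k) = {f} := LevelTwoBlockTranslate.range_vec_one f
  have hfprime : (Ideal.span {f}).IsPrime := (Ideal.span_singleton_prime (prime_f k f hf).ne_zero).mpr (prime_f k f hf)
  haveI hpr : (Ideal.span (Set.range (![f] : Fin 1 → MvPolynomial (Fin 5) k))).IsPrime := by rw [hr]; exact hfprime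
  haveI : IsDomain (MvPolynomial (Fin 5) k ⧸ Ideal.span (Set.range (![f] : Fin 1 → MvPolynomial (Fin 5) k))) := Ideal.Quotient.isDomain _
  haveI : CharP (MvPolynomial (Fin 5) k ⧸ Ideal.span (Set.range (![f] : Fin 1 → MvPolynomial (Fin 5) k))) 2 :=
    charP_of_injective_algebraMap (algebraMap k _).injective 2
  have hXne : ∀ v : Fin 5, Ideal.Quotient.mk (Ideal.span (Set.range (![f] : Fin 1 → MvPolynomial (Fin 5) k))) (X v) ≠ 0 := by
    intro v h0
    have hmem : (X v : MvPolynomial (Fin 5) k) ∈ Ideal.span (Set.range (![f] : Fin 1 → MvPolynomial (Fin 5) k)) :=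
      Ideal.Quotient.eq_zero_iff_mem.mp h0
    rw [hr] at hmem
    by_cases hv : v = 1
    · subst hv
      refine mk_X_ne_zero_of_eval k f hfprime 1 (Pi.single 2 1) (by simp) ?_ (Ideal.Quotient.eq_zero_iff_mem.mpr hmem)
      rw [hf]; simp
    · refine mk_X_ne_zero_of_eval k f hfprime v (Pi.single 1 1) (Pi.single_eq_of_ne hv _) ?_ (Ideal.Quotient.eq_zero_iff_mem.mpr hmem)
      rw [hf]; simp
  have hθF' : ∀ (c : Fin 13) (l : Fin 1), aeval (fun j : Fin 5 => ∏ i : Fin 5, (X i : MvPolynomial (Fin 5) k) ^ P2d4CTauKChar2Fan.V c i j)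
      ((![f] : Fin 1 → MvPolynomial (Fin 5) k) l) =
      monomial (P2d4CTauKChar2Fan.d c l) (1 : k) *
        (fun c : Fin 13 => (![KLocCellKit.evalL k (P2d4CTauKChar2Fan.G c)] : Fin 1 → MvPolynomial (Fin 5) k)) c l := by
    intro c l
    fin_cases l
    exact P2d4CTauKChar2Fan.hθF₀ k c
  have hon := RoadBFrame.hon_of_kernelChecks 2 k 5 13 P2d4CTauKChar2Fan.V P2d4CTauKChar2Fan.G (P2d4CTauKChar2Fan.hg0 k)
    (P2d4CTauKChar2Fan.hX k) P2d4CTauKChar2Fan.CELLS P2d4CTauKChar2Fan.hcheck P2d4CTauKChar2Fan.hSS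
  obtain ⟨hcovR, hv0, hon'⟩ := CICertificates.ciCertificates 2 k Finset.univ P2d4CTauKChar2Fan.A P2d4CTauKChar2Fan.hprim 13
    P2d4CTauKChar2Fan.m (P2d4CTauKChar2Fan.hcov k) P2d4CTauKChar2Fan.V P2d4CTauKChar2Fan.hV P2d4CTauKChar2Fan.a
    P2d4CTauKChar2Fan.haA P2d4CTauKChar2Fan.hgen P2d4CTauKChar2Fan.hge (![f] : Fin 1 → MvPolynomial (Fin 5) k) hpr hXne
    (fun c : Fin 13 => (![KLocCellKit.evalL k (P2d4CTauKChar2Fan.G c)] : Fin 1 → MvPolynomial (Fin 5) k)) P2d4CTauKChar2Fan.d hθF'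
    P2d4CTauKChar2Fan.hunit hon (P2d4CTauKChar2Fan.hv k _)
  intro y hy
  exact PointFixableOfCert.affineBlowup_fiClause_over_of_cert 2 _ _ 13 _ (P2d4CTauKChar2Fan.hv k _) hcovR hv0 hon' y hy

/-! ## §2 ★★ Everywhere, in the presentation `k[X]/(f)`; the support; every blowing up -/

set_option maxHeartbeats 800000 in
-- presentation rewrite + one blow-up-is-iso transport
/-- ★★ **THE BLOWING UP OF `X = V(z² + x⁴z + y³ + u³ + t³) ⊂ 𝔸⁵_k` (`char k = 2`) ALONG THE Σ_τ-REFINING MONOMIAL CENTRE `I_{A′}` IS FULL AT EVERY POINT**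
(explicit model `affineBlowup I_{A′}`, centre PINNED as the image of `(x^e : e ∈ P2d4CTauKChar2Fan.A)`): over the vertex by §1; elsewhere `X` is regular
(`FCentreE1RungZero.regular_off_vertex`) and the blow-up is a local isomorphism (`IsBlowup.isIso_compl`), so the stalk is regular, hence FULL.
[OURS · certificate instance; cite: Fedder1983, Thm. 1.12; StacksProject, Tag 0804; GortzWedhorn2020, Prop. 13.91] -/
theorem affineBlowup_tauK_fullCl (k : Type) [Field k] [CharP k 2] (f : MvPolynomial (Fin 5) k)
    (hf : f = X 4 ^ 2 + X 0 ^ 4 * X 4 + X 1 ^ 3 + X 2 ^ 3 + X 3 ^ 3) :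
    ∀ y : ↥(affineBlowup (Ideal.span ((fun e : Fin 5 →₀ ℕ => Ideal.Quotient.mk (Ideal.span {f}) (monomial e (1 : k))) ''
        (P2d4CTauKChar2Fan.A : Set (Fin 5 →₀ ℕ))))),
      FullCl 2 ((affineBlowup (Ideal.span ((fun e : Fin 5 →₀ ℕ => Ideal.Quotient.mk (Ideal.span {f}) (monomial e (1 : k))) ''
        (P2d4CTauKChar2Fan.A : Set (Fin 5 →₀ ℕ))))).presheaf.stalk y) := by
  classical
  haveI : Fact (Nat.Prime 2) := ⟨Nat.prime_two⟩
  subst hf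
  -- §1 in the presentation `k[X]/(f)`
  have hover := affineBlowup_tauK_fullCl_over k _ rfl
  rw [LevelTwoBlockTranslate.range_vec_one] at hover
  set f : MvPolynomial (Fin 5) k := X 4 ^ 2 + X 0 ^ 4 * X 4 + X 1 ^ 3 + X 2 ^ 3 + X 3 ^ 3 with hf
  haveI hfprime : (Ideal.span {f}).IsPrime := (Ideal.span_singleton_prime (prime_f k f hf).ne_zero).mpr (prime_f k f hf)
  haveI : IsDomain (MvPolynomial (Fin 5) k ⧸ Ideal.span {f}) := Ideal.Quotient.isDomain _
  set I : Ideal (MvPolynomial (Fin 5) k ⧸ Ideal.span {f}) :=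
    Ideal.span ((fun e : Fin 5 →₀ ℕ => Ideal.Quotient.mk (Ideal.span {f}) (monomial e (1 : k))) '' (P2d4CTauKChar2Fan.A : Set (Fin 5 →₀ ℕ))) with hI
  intro y
  by_cases hy : I ≤ ((affineBlowup.π I).base y).asIdeal
  · exact hover y hy
  · -- off the vertex: `X` regular there and `π` an isomorphism over the complement of `V(I) = {vertex}`
    have hvert : ¬ Ideal.span (Set.range fun j : Fin 5 => Ideal.Quotient.mk (Ideal.span {f}) (X j)) ≤ ((affineBlowup.π I).base y).asIdeal := by
      intro hle
      exact hy ((CICertificates.centre_le_iff (Ideal.span {f}) Finset.univ P2d4CTauKChar2Fan.A P2d4CTauKChar2Fan.hAJ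
        P2d4CTauKChar2Fan.hprim _).mpr fun j _ => hle (Ideal.subset_span ⟨j, rfl⟩))
    have hreg : (affineBlowup.π I).base y ∈ Scheme.regularLocus (Spec (.of (MvPolynomial (Fin 5) k ⧸ Ideal.span {f}))) :=
      FermatCubicConeGerm.mem_regularLocus_Spec_of_isRegularLocalRing _ (regular_off_vertex k f hf _ hvert)
    have hsupp : (affineBlowup.π I).base y ∉ ((affineBlowup.idealSheaf I).support : Set (Spec (.of (MvPolynomial (Fin 5) k ⧸ Ideal.span {f})))) := by
      rw [affineBlowup.support_idealSheaf]
      exact fun h => hy fun r hr => h hr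
    haveI := (affineBlowup.isBlowup I).isIso_compl
    let U : (Spec (.of (MvPolynomial (Fin 5) k ⧸ Ideal.span {f}))).Opens :=
      ⟨((affineBlowup.idealSheaf I).support : Set (Spec (.of (MvPolynomial (Fin 5) k ⧸ Ideal.span {f}))))ᶜ,
        (affineBlowup.idealSheaf I).support.isClosed.isOpen_compl⟩
    have hyU : (affineBlowup.π I).base y ∈ U := hsupp
    have hreg' : y ∈ Scheme.regularLocus (affineBlowup I) :=
      (mem_regularLocus_iff_of_isIso_morphismRestrict (affineBlowup.π I) U y hyU).mpr hreg
    rw [Scheme.mem_regularLocus] at hreg'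
    haveI := hreg'
    haveI := FTemkinClosedPoints.charP_stalk_of_over 2
      (Spec.map (CommRingCat.ofHom (algebraMap k (MvPolynomial (Fin 5) k ⧸ Ideal.span {f})))) (affineBlowup.π I) y
    exact FTemkinClosedPoints.fullCl_of_isRegularLocalRing 2 _

/-- **The support of the centre `Ĩ_{A′}` is the vertex** (the monomial ideal is `𝔪`-primary: pure powers of all five variables lie in `A′`).
[folklore; cite: StacksProject, Tag 0804] -/
theorem support_idealSheaf_tauK (k : Type) [Field k] [CharP k 2] (f : MvPolynomial (Fin 5) k)
    (hf : f = X 4 ^ 2 + X 0 ^ 4 * X 4 + X 1 ^ 3 + X 2 ^ 3 + X 3 ^ 3)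
    (v : Spec (.of (MvPolynomial (Fin 5) k ⧸ Ideal.span {f})))
    (hv : v.asIdeal = Ideal.span (Set.range fun j : Fin 5 => Ideal.Quotient.mk (Ideal.span {f}) (X j))) :
    ((affineBlowup.idealSheaf (Ideal.span ((fun e : Fin 5 →₀ ℕ => Ideal.Quotient.mk (Ideal.span {f}) (monomial e (1 : k))) ''
        (P2d4CTauKChar2Fan.A : Set (Fin 5 →₀ ℕ))))).support : Set (Spec (.of (MvPolynomial (Fin 5) k ⧸ Ideal.span {f})))) = {v} := by
  have hmax : v.asIdeal.IsMaximal := by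
    rw [hv]; exact DoublePointFermatCubicGerm.isMaximal_origin k f (constantCoeff_f k f hf)
  rw [affineBlowup.support_idealSheaf]
  ext w
  change ((Ideal.span ((fun e : Fin 5 →₀ ℕ => Ideal.Quotient.mk (Ideal.span {f}) (monomial e (1 : k))) ''
      (P2d4CTauKChar2Fan.A : Set (Fin 5 →₀ ℕ))) : Ideal (MvPolynomial (Fin 5) k ⧸ Ideal.span {f})) :
      Set (MvPolynomial (Fin 5) k ⧸ Ideal.span {f})) ⊆ (w.asIdeal : Set (MvPolynomial (Fin 5) k ⧸ Ideal.span {f})) ↔ w = v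
  rw [SetLike.coe_subset_coe,
    CICertificates.centre_le_iff (Ideal.span {f}) Finset.univ P2d4CTauKChar2Fan.A P2d4CTauKChar2Fan.hAJ P2d4CTauKChar2Fan.hprim]
  constructor
  · intro h
    have hle : v.asIdeal ≤ w.asIdeal := by
      rw [hv, Ideal.span_le]
      rintro _ ⟨j, rfl⟩
      exact h j (Finset.mem_univ j)
    exact PrimeSpectrum.ext (hmax.eq_of_le w.isPrime.ne_top hle).symm
  · rintro rfl j _
    rw [hv]
    exact Ideal.subset_span ⟨j, rfl⟩

/-- ★★ **EVERY BLOWING UP OF `X` ALONG `Ĩ_{A′}` IS FULL AT EVERY POINT** — the pinned-centre, universally-quantified form F4POS-2b consumes (any two blowings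
up along the same centre are isomorphic over `X`, `IsBlowup.unique`; FULL moves along isomorphic stalks). [OURS · certificate instance; cite: GortzWedhorn2020, Prop. 13.92] -/
theorem forall_isBlowup_tauK_fullCl (k : Type) [Field k] [CharP k 2] (f : MvPolynomial (Fin 5) k)
    (hf : f = X 4 ^ 2 + X 0 ^ 4 * X 4 + X 1 ^ 3 + X 2 ^ 3 + X 3 ^ 3) :
    affineBlowup.idealSheaf (Ideal.span ((fun e : Fin 5 →₀ ℕ => Ideal.Quotient.mk (Ideal.span {f}) (monomial e (1 : k))) ''
        (P2d4CTauKChar2Fan.A : Set (Fin 5 →₀ ℕ)))) ≠ ⊥ ∧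
    ∀ (X' : Scheme.{0}) (π : X' ⟶ Spec (.of (MvPolynomial (Fin 5) k ⧸ Ideal.span {f}))),
      IsBlowup π (affineBlowup.idealSheaf (Ideal.span ((fun e : Fin 5 →₀ ℕ => Ideal.Quotient.mk (Ideal.span {f}) (monomial e (1 : k))) ''
        (P2d4CTauKChar2Fan.A : Set (Fin 5 →₀ ℕ))))) →
      ∀ x' : X', FullCl 2 (X'.presheaf.stalk x') := by
  haveI hfprime : (Ideal.span {f}).IsPrime := (Ideal.span_singleton_prime (prime_f k f hf).ne_zero).mpr (prime_f k f hf)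
  haveI : IsDomain (MvPolynomial (Fin 5) k ⧸ Ideal.span {f}) := Ideal.Quotient.isDomain _
  have hIne : Ideal.span ((fun e : Fin 5 →₀ ℕ => Ideal.Quotient.mk (Ideal.span {f}) (monomial e (1 : k))) ''
      (P2d4CTauKChar2Fan.A : Set (Fin 5 →₀ ℕ))) ≠ ⊥ := by
    intro h0
    have hmem := P2d4CTauKChar2Fan.hv k ![f] 0
    rw [LevelTwoBlockTranslate.range_vec_one] at hmem
    rw [h0] at hmem
    have hzero := (Submodule.mem_bot _).mp hmem
    -- `x̄^{m 0} ≠ 0` in the domain `k[X]/(f)` (no variable is zero)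
    have hXne : ∀ j : Fin 5, Ideal.Quotient.mk (Ideal.span {f}) (X j) ≠ 0 := by
      intro j
      by_cases hj : j = 1
      · subst hj
        exact mk_X_ne_zero_of_eval k f hfprime 1 (Pi.single 2 1) (by simp) (by rw [hf]; simp)
      · exact mk_X_ne_zero_of_eval k f hfprime j (Pi.single 1 1) (Pi.single_eq_of_ne hj _) (by rw [hf]; simp)
    apply (show Ideal.Quotient.mk (Ideal.span {f}) (monomial (P2d4CTauKChar2Fan.m 0) (1 : k)) ≠ 0 from ?_) hzero
    rw [monomial_eq, C_1, one_mul, Finsupp.prod, map_prod]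
    exact Finset.prod_ne_zero_iff.mpr fun j _ => by rw [map_pow]; exact pow_ne_zero _ (hXne j)
  haveI := affineBlowup.isIntegral hIne
  refine ⟨RegularBlowupModelDim2.ne_bot_of_isBlowup (affineBlowup.isBlowup _), fun X' π hπ x' => ?_⟩
  obtain ⟨e, -, -⟩ := (affineBlowup.isBlowup _).unique hπ
  exact FTemkinClosedPoints.fullCl_of_isIso_stalkMap' 2 e.inv x' (affineBlowup_tauK_fullCl k f hf (e.inv.base x'))

/-! ## §3 ★ The centre IS the product `τ·K`; the export in F4POS-2b's letter -/

/-- The monomials `x^τ`, `τ ∈ TL` (exponents of `x², y, u, t, z`), lie in `span {x̄0², x̄1, x̄2, x̄3, x̄4}` of `k[X]/(f)`. [folklore] -/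
theorem mk_monomial_mem_span_tau (k : Type) [Field k] (f : MvPolynomial (Fin 5) k) (v : Fin 5 → ℕ)
    (hv : v ∈ P2d4CTauKChar2Fan.TL) :
    Ideal.Quotient.mk (Ideal.span {f}) (monomial (Finsupp.equivFunOnFinite.symm v) (1 : k)) ∈
      Ideal.span {Ideal.Quotient.mk (Ideal.span {f}) (X 0) ^ 2, Ideal.Quotient.mk (Ideal.span {f}) (X 1),
        Ideal.Quotient.mk (Ideal.span {f}) (X 2), Ideal.Quotient.mk (Ideal.span {f}) (X 3), Ideal.Quotient.mk (Ideal.span {f}) (X 4)} := by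
  rw [P2d4CTauKChar2Fan.hTL] at hv
  simp only [List.mem_cons, List.not_mem_nil, or_false] at hv
  rcases hv with rfl | rfl | rfl | rfl | rfl <;>
    rw [Finsupp.equivFunOnFinite_symm_single, ← X_pow_eq_monomial, map_pow] <;>
    exact Ideal.subset_span (by simp)

/-- Every generator of `{x̄0², x̄1, x̄2, x̄3, x̄4}` is a monomial `x^τ`, `τ ∈ TL`. [folklore] -/
theorem exists_TL_of_mem_tauGens (k : Type) [Field k] (f : MvPolynomial (Fin 5) k)
    {r : MvPolynomial (Fin 5) k ⧸ Ideal.span {f}}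
    (hr : r ∈ ({Ideal.Quotient.mk (Ideal.span {f}) (X 0) ^ 2, Ideal.Quotient.mk (Ideal.span {f}) (X 1),
        Ideal.Quotient.mk (Ideal.span {f}) (X 2), Ideal.Quotient.mk (Ideal.span {f}) (X 3), Ideal.Quotient.mk (Ideal.span {f}) (X 4)} :
        Set (MvPolynomial (Fin 5) k ⧸ Ideal.span {f}))) :
    ∃ v ∈ P2d4CTauKChar2Fan.TL,
      r = Ideal.Quotient.mk (Ideal.span {f}) (monomial (Finsupp.equivFunOnFinite.symm v) (1 : k)) := by
  rw [P2d4CTauKChar2Fan.hTL]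
  rcases hr with rfl | rfl | rfl | rfl | rfl
  · exact ⟨Pi.single 0 2, by decide, by rw [Finsupp.equivFunOnFinite_symm_single, ← X_pow_eq_monomial, map_pow]⟩
  · exact ⟨Pi.single 1 1, by decide, by rw [Finsupp.equivFunOnFinite_symm_single, ← X_pow_eq_monomial, pow_one]⟩
  · exact ⟨Pi.single 2 1, by decide, by rw [Finsupp.equivFunOnFinite_symm_single, ← X_pow_eq_monomial, pow_one]⟩
  · exact ⟨Pi.single 3 1, by decide, by rw [Finsupp.equivFunOnFinite_symm_single, ← X_pow_eq_monomial, pow_one]⟩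
  · exact ⟨Pi.single 4 1, by decide, by rw [Finsupp.equivFunOnFinite_symm_single, ← X_pow_eq_monomial, pow_one]⟩

/-- Products of monomials in `k[X]/(f)`, on raw exponent vectors. [folklore] -/
theorem mk_monomial_symm_add (k : Type) [Field k] (f : MvPolynomial (Fin 5) k) (u w : Fin 5 → ℕ) :
    Ideal.Quotient.mk (Ideal.span {f}) (monomial (Finsupp.equivFunOnFinite.symm (u + w)) (1 : k)) =
      Ideal.Quotient.mk (Ideal.span {f}) (monomial (Finsupp.equivFunOnFinite.symm u) (1 : k)) *
        Ideal.Quotient.mk (Ideal.span {f}) (monomial (Finsupp.equivFunOnFinite.symm w) (1 : k)) := by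
  rw [← map_mul, monomial_mul, one_mul, Q6CNKit.symm_add]

/-- ★ **THE CERTIFIED CENTRE IS LITERALLY THE PRODUCT `τ·K`**: in `k[X]/(f)` (any `f`), `span (x^A) = span {x̄0², x̄1, x̄2, x̄3, x̄4} * span (x^KA)`.
`⊆`: every `x^a`, `a ∈ A`, is a multiple of some `x^τ · x^b` (`P2d4CTauKChar2Fan.hAK_raw`); `⊇`: every `x^τ · x^b` is a multiple of some `x^a` (`hKA_raw`); both tables are
ONE kernel `decide` each on res-L1-w45a-idea-1's product certificate ada44c2874c63a18 / factor file 6984e77c8fc6f0f1 (minimal generators `62 = 62`). [OURS · certificate instance]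
[folklore; cite: CoxLittleSchenck2011, §2.3] -/
theorem span_A_eq_tau_mul_K (k : Type) [Field k] (f : MvPolynomial (Fin 5) k) :
    Ideal.span ((fun e : Fin 5 →₀ ℕ => Ideal.Quotient.mk (Ideal.span {f}) (monomial e (1 : k))) ''
        (P2d4CTauKChar2Fan.A : Set (Fin 5 →₀ ℕ))) =
      Ideal.span {Ideal.Quotient.mk (Ideal.span {f}) (X 0) ^ 2, Ideal.Quotient.mk (Ideal.span {f}) (X 1),
          Ideal.Quotient.mk (Ideal.span {f}) (X 2), Ideal.Quotient.mk (Ideal.span {f}) (X 3), Ideal.Quotient.mk (Ideal.span {f}) (X 4)} *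
        Ideal.span ((fun e : Fin 5 →₀ ℕ => Ideal.Quotient.mk (Ideal.span {f}) (monomial e (1 : k))) ''
          (P2d4CTauKChar2Fan.KA : Set (Fin 5 →₀ ℕ))) := by
  classical
  apply le_antisymm
  · rw [Ideal.span_le]
    rintro _ ⟨e, he, rfl⟩
    obtain ⟨v, hv, rfl⟩ := Q6CNKit.exists_of_mem_image_symm P2d4CTauKChar2Fan.AL e he
    obtain ⟨τ, hτ, b, hb, hle⟩ := P2d4CTauKChar2Fan.hAK_raw v hv
    have hv' : v = (v - (τ + b)) + (τ + b) := by
      funext i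
      have := hle i
      simp only [Pi.add_apply, Pi.sub_apply]
      omega
    rw [SetLike.mem_coe]
    beta_reduce
    rw [hv', mk_monomial_symm_add, mk_monomial_symm_add k f τ b]
    exact Ideal.mul_mem_left _ _ (Ideal.mul_mem_mul (mk_monomial_mem_span_tau k f τ hτ)
      (Ideal.subset_span ⟨_, (Q6CNKit.mem_image_symm P2d4CTauKChar2Fan.KL b).mpr hb, rfl⟩))
  · rw [Ideal.span_mul_span', Ideal.span_le]
    rintro _ ⟨r, hr, _, ⟨e, he, rfl⟩, rfl⟩
    obtain ⟨τ, hτ, rfl⟩ := exists_TL_of_mem_tauGens k f hr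
    obtain ⟨b, hb, rfl⟩ := Q6CNKit.exists_of_mem_image_symm P2d4CTauKChar2Fan.KL e he
    obtain ⟨v, hv, hle⟩ := P2d4CTauKChar2Fan.hKA_raw τ hτ b hb
    have h' : τ + b = (τ + b - v) + v := by
      funext i
      have := hle i
      simp only [Pi.add_apply, Pi.sub_apply]
      omega
    rw [SetLike.mem_coe]
    beta_reduce
    rw [← mk_monomial_symm_add, h', mk_monomial_symm_add]
    exact Ideal.mul_mem_left _ _ (Ideal.subset_span ⟨_, (Q6CNKit.mem_image_symm P2d4CTauKChar2Fan.AL v).mpr hv, rfl⟩)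

/-- `K ≠ ⊥` in the domain `k[X]/(f)`: `x̄⁵ ∈ K` and `x̄ ≠ 0`. [folklore] -/
theorem span_KA_ne_bot (k : Type) [Field k] [CharP k 2] (f : MvPolynomial (Fin 5) k)
    (hf : f = X 4 ^ 2 + X 0 ^ 4 * X 4 + X 1 ^ 3 + X 2 ^ 3 + X 3 ^ 3) :
    Ideal.span ((fun e : Fin 5 →₀ ℕ => Ideal.Quotient.mk (Ideal.span {f}) (monomial e (1 : k))) ''
        (P2d4CTauKChar2Fan.KA : Set (Fin 5 →₀ ℕ))) ≠ ⊥ := by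
  haveI hfprime : (Ideal.span {f}).IsPrime := (Ideal.span_singleton_prime (prime_f k f hf).ne_zero).mpr (prime_f k f hf)
  intro h0
  have hmem : Ideal.Quotient.mk (Ideal.span {f}) (monomial (Finsupp.single 0 5) (1 : k)) ∈
      Ideal.span ((fun e : Fin 5 →₀ ℕ => Ideal.Quotient.mk (Ideal.span {f}) (monomial e (1 : k))) ''
        (P2d4CTauKChar2Fan.KA : Set (Fin 5 →₀ ℕ))) :=
    Ideal.subset_span ⟨_, Q6CNKit.single_mem P2d4CTauKChar2Fan.KL 0 5 P2d4CTauKChar2Fan.hKprim_raw.1, rfl⟩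
  rw [h0, Ideal.mem_bot, ← X_pow_eq_monomial, map_pow] at hmem
  exact pow_ne_zero 5 (mk_X_ne_zero_of_eval k f hfprime 0 (Pi.single 1 1) (by simp) (by rw [hf]; simp)) hmem

/-- `𝔪_v = (x̄0, …, x̄4) ⊆ √K`: the pure powers `x⁵, y³, u³, t³, z³` lie in `KA`. [folklore] -/
theorem span_range_X_le_radical_span_KA (k : Type) [Field k] (f : MvPolynomial (Fin 5) k) :
    Ideal.span (Set.range fun j : Fin 5 => Ideal.Quotient.mk (Ideal.span {f}) (X j)) ≤
      (Ideal.span ((fun e : Fin 5 →₀ ℕ => Ideal.Quotient.mk (Ideal.span {f}) (monomial e (1 : k))) ''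
        (P2d4CTauKChar2Fan.KA : Set (Fin 5 →₀ ℕ)))).radical := by
  obtain ⟨h0, h1, h2, h3, h4⟩ := P2d4CTauKChar2Fan.hKprim_raw
  have key : ∀ (j : Fin 5) (N : ℕ), (Pi.single j N : Fin 5 → ℕ) ∈ P2d4CTauKChar2Fan.KL →
      Ideal.Quotient.mk (Ideal.span {f}) (X j : MvPolynomial (Fin 5) k) ∈
        (Ideal.span ((fun e : Fin 5 →₀ ℕ => Ideal.Quotient.mk (Ideal.span {f}) (monomial e (1 : k))) ''
          (P2d4CTauKChar2Fan.KA : Set (Fin 5 →₀ ℕ)))).radical := by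
    intro j N hN
    refine ⟨N, ?_⟩
    rw [← map_pow, X_pow_eq_monomial]
    exact Ideal.subset_span ⟨_, Q6CNKit.single_mem P2d4CTauKChar2Fan.KL j N hN, rfl⟩
  rw [Ideal.span_le]
  rintro _ ⟨j, rfl⟩
  fin_cases j
  exacts [key 0 5 h0, key 1 3 h1, key 2 3 h2, key 3 3 h3, key 4 3 h4]

/-- ★★ **F4POS-2a′ ROW IN F4POS-2b's LETTER**: `∀ y : affineBlowup (τ_f * K), FullCl 2 (stalk y)` for `τ_f = span {x̄0², x̄1, x̄2, x̄3, x̄4}` and `K = span (x^KA)`, written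
EXACTLY as the binder `hrow` of `FHalfRowOfProductCentre.tauFloor_P2d4C_cure` (p618085) — §2 transported along §3. The τ-floor row is then
`tauFloor_P2d4C_cure k f hf v hv _ (span_KA_ne_bot k f hf) (span_range_X_le_radical_span_KA k f) (hrow_P2d4C k f hf)` (res-L1-w45a-stub-3's append, RULING R18.18).
[OURS · certificate instance; cite: Fedder1983, Thm. 1.12; GortzWedhorn2020, Prop. 13.91] -/
theorem hrow_P2d4C (k : Type) [Field k] [CharP k 2] (f : MvPolynomial (Fin 5) k)
    (hf : f = X 4 ^ 2 + X 0 ^ 4 * X 4 + X 1 ^ 3 + X 2 ^ 3 + X 3 ^ 3) :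
    ∀ y : ↥(affineBlowup
        (Ideal.span {Ideal.Quotient.mk (Ideal.span {f}) (X 0) ^ 2, Ideal.Quotient.mk (Ideal.span {f}) (X 1),
            Ideal.Quotient.mk (Ideal.span {f}) (X 2), Ideal.Quotient.mk (Ideal.span {f}) (X 3), Ideal.Quotient.mk (Ideal.span {f}) (X 4)} *
          Ideal.span ((fun e : Fin 5 →₀ ℕ => Ideal.Quotient.mk (Ideal.span {f}) (monomial e (1 : k))) ''
            (P2d4CTauKChar2Fan.KA : Set (Fin 5 →₀ ℕ))))),
      FullCl 2 ((affineBlowup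
        (Ideal.span {Ideal.Quotient.mk (Ideal.span {f}) (X 0) ^ 2, Ideal.Quotient.mk (Ideal.span {f}) (X 1),
            Ideal.Quotient.mk (Ideal.span {f}) (X 2), Ideal.Quotient.mk (Ideal.span {f}) (X 3), Ideal.Quotient.mk (Ideal.span {f}) (X 4)} *
          Ideal.span ((fun e : Fin 5 →₀ ℕ => Ideal.Quotient.mk (Ideal.span {f}) (monomial e (1 : k))) ''
            (P2d4CTauKChar2Fan.KA : Set (Fin 5 →₀ ℕ))))).presheaf.stalk y) := by
  rw [← span_A_eq_tau_mul_K k f]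
  exact affineBlowup_tauK_fullCl k f hf

end Summit.ResolutionOfSingularities.ResolutionOfSingularities.Theorems.FInjectiveMacaulayfication.P2d4CTauKBlowupFull

end
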